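import Summits.QuantumFields.GaugeBoot.OneOverNExpansion
import HarnessLib

/-!
# The `1/N` expansion to all orders: identification and uniqueness of the coefficients (gauge-boot, ADDENDUM 30 part F)

HONEST FRAMING (cell `pub-gaugeboot`, page 1 of every file): the venture produces certified bounds
on lattice expectations at stated coupling, gauge group, dimension and torus size; NOT a mass gap,
NOT a continuum limit, NOT a string tension; NOT Yang–Mills-summit-bearing (barriers
`FixedCouplingUltralocality`, `PerturbativeInvisibility`).  Strong-coupling `SO(N)` lattice gauge theory with free boundary
condition (S. Chatterjee, Comm. Math. Phys. **366** (2019); S. Chatterjee, J. Jafarov, arXiv:1604.04777); nothing about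
four-dimensional continuum Yang–Mills or a mass gap.

## Content

★★★ `oneOverN_coefficients` — the sibling's `1/N` expansion (`OneOverNExpansion.oneOverN_expansion`) repackaged with
(a) normalised constants `C_k ≥ 0`, `L_k ≥ 1`; (b) the IDENTIFICATION OF THE ZEROTH COEFFICIENT with the string sum of
gauge–string duality, `f_0(β, s) = Σ_{X ∈ 𝒳(s)} w_β(X)` (Chatterjee 2019, Theorem 3.1; by uniqueness for the symmetrized equation,
ADDENDUM 28), so that the `k = 1` statement reads `N(⟨W_{l₁}⋯W_{lₙ}⟩/Nⁿ − Σ_X w_β(X)) → f_1`; (c) UNIQUENESS OF THE HIERARCHY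
(Chatterjee–Jafarov, Theorem 5.6): for every `k` and every class `(M, L)` there is `β₁(d,k,M,L) > 0` such that for `|β| ≤ β₁` any
functions `g_0, …, g_k` of class `M L^{|s|}` with `g_0(∅) = 1`, `g_i(∅) = 0` and the recursion (5.2) coincide with `f_0, …, f_k`
on loop sequences in minimal representation — the coefficients are canonical, whichever way they are produced (limits here;
string sums of genus `k/2` in the source).  Also `superlog_linear`: the cubes `[−N, N]^d` are admissible.

Everything is `[folklore]` given the siblings.
-/

noncomputable section

open Filter Topology
open Literature.Probability.LatticeModels (Site box)
open Literature.MathematicalPhysics.QuantumFieldTheory (latticeNorm)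
open Literature.MathematicalPhysics.QuantumFieldTheory.Chatterjee2019LargeN
open Literature.MathematicalPhysics.QuantumFieldTheory.Chatterjee2019LargeN.CoeffCatalanBoundProof

namespace Summit.QuantumFields.GaugeBoot

namespace StringDuality

variable {d : ℕ}

/-! ## Linear cubes are admissible -/

/-- `L² ≤ 2·2^L`. [folklore] -/
theorem sq_le_two_mul_two_pow : ∀ L : ℕ, L * L ≤ 2 * 2 ^ L
  | 0 => by norm_num
  | 1 => by norm_num
  | 2 => by norm_num
  | 3 => by norm_num
  | L + 4 => by
      have ih := sq_le_two_mul_two_pow (L + 3)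
      have h : (L + 4) * (L + 4) ≤ 2 * ((L + 3) * (L + 3)) := by nlinarith
      calc (L + 4) * (L + 4) ≤ 2 * ((L + 3) * (L + 3)) := h
        _ ≤ 2 * (2 * 2 ^ (L + 3)) := Nat.mul_le_mul_left 2 ih
        _ = 2 * 2 ^ (L + 4) := by ring

/-- **The cubes `[−N, N]^d` grow super-logarithmically**: `a·log₂N ≤ N` eventually, for every `a`. [folklore] -/
theorem superlog_linear (a : ℕ) : ∀ᶠ N : ℕ in atTop, a * Nat.log 2 N ≤ N := by
  filter_upwards [eventually_ge_atTop (2 ^ (2 * a))] with N hN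
  have h1 : 2 * a ≤ Nat.log 2 N := Nat.le_log_of_pow_le one_lt_two hN
  have hN0 : N ≠ 0 := by have := Nat.one_le_two_pow (n := 2 * a); omega
  have h2 : 2 ^ Nat.log 2 N ≤ N := Nat.pow_log_le_self 2 hN0
  have h3 := sq_le_two_mul_two_pow (Nat.log 2 N)
  nlinarith

variable (d)

/-- ★★★ **The `1/N` expansion to all orders, with the coefficients identified and unique.**  See the module docstring and
`oneOverN_expansion` (`F (k+2) β = f_k(β, ·)`, `F 0 = F 1 = 0`).
[cite: ChatterjeeJafarov2016OneOverN, Theorem 3.1 (ii), (iii), Theorem 5.1, Theorem 5.6; Chatterjee2019LargeN, Theorem 3.1, Theorem 9.9] -/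
theorem oneOverN_coefficients (hd : 2 ≤ d) :
    ∃ β₀ : ℕ → ℝ, (∀ k, 0 < β₀ k) ∧ (∀ k, β₀ (k + 1) ≤ β₀ k) ∧
    ∃ C L : ℕ → ℝ, (∀ k, 0 ≤ C k) ∧ (∀ k, 1 ≤ L k) ∧ ∃ F : ℕ → ℝ → LoopSeq d → ℝ,
      (∀ (β : ℝ) (u : LoopSeq d), F 0 β u = 0) ∧ (∀ (β : ℝ) (u : LoopSeq d), F 1 β u = 0) ∧
      -- (A) the expansion, order by order
      (∀ (k : ℕ) (β : ℝ), |β| ≤ β₀ k →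
        F (k + 2) β [] = (if k = 0 then 1 else 0) ∧
        (∀ s : LoopSeq d, IsLoopSeq s → |F (k + 2) β s| ≤ C k * L k ^ s.len) ∧
        (∀ s : LoopSeq d, IsLoopSeq s → s ≠ [] →
          (s.len : ℝ) * F (k + 2) β s -
              ((∑ o : InvIdx s, F (k + 2) β (s.negSplitAt o)) - (∑ o : SameIdx s, F (k + 2) β (s.posSplitAt o))
                + β * (∑ o : DeformIdx s, F (k + 2) β (s.negDeformAt o))
                - β * (∑ o : DeformIdx s, F (k + 2) β (s.posDeformAt o))) =
            (s.len : ℝ) * F (k + 1) β s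
              + ((∑ o : SameIdx s, F (k + 1) β (s.negTwistAt o)) - ∑ o : InvIdx s, F (k + 1) β (s.posTwistAt o))
              + ((∑ o : MergeIdx s, F k β (s.negMergeAt o)) - ∑ o : MergeIdx s, F k β (s.posMergeAt o))) ∧
        (∀ M : ℕ → ℕ, (∀ a : ℕ, ∀ᶠ N : ℕ in atTop, a * Nat.log 2 N ≤ M N) → ∀ s : LoopSeq d, IsLoopSeq s →
          Tendsto (fun N : ℕ => (N : ℝ) ^ k *
            (phi N β (box d (M N)) s - ∑ i ∈ Finset.range k, F (i + 2) β s / (N : ℝ) ^ i)) atTop (𝓝 (F (k + 2) β s)))) ∧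
      -- (B) the zeroth coefficient is the string sum of gauge–string duality
      (∀ β : ℝ, |β| ≤ β₀ 0 → ∀ s : LoopSeq d, IsLoopSeq s → F 2 β s = ∑' X : Trajectory s, X.weight β) ∧
      -- (C) uniqueness of the hierarchy
      (∀ (k : ℕ) (Mb Lb : ℝ), 0 ≤ Mb → 1 ≤ Lb → ∃ β₁ : ℝ, 0 < β₁ ∧ ∀ β : ℝ, |β| ≤ β₁ → ∀ G : ℕ → LoopSeq d → ℝ,
        (∀ u : LoopSeq d, G 0 u = 0) → (∀ u : LoopSeq d, G 1 u = 0) →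
        (∀ i, i ≤ k → G (i + 2) [] = if i = 0 then 1 else 0) →
        (∀ i, i ≤ k → ∀ s : LoopSeq d, IsLoopSeq s → |G (i + 2) s| ≤ Mb * Lb ^ s.len) →
        (∀ i, i ≤ k → ∀ s : LoopSeq d, IsLoopSeq s → s ≠ [] →
          (s.len : ℝ) * G (i + 2) s -
              ((∑ o : InvIdx s, G (i + 2) (s.negSplitAt o)) - (∑ o : SameIdx s, G (i + 2) (s.posSplitAt o))
                + β * (∑ o : DeformIdx s, G (i + 2) (s.negDeformAt o)) - β * (∑ o : DeformIdx s, G (i + 2) (s.posDeformAt o))) =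
            (s.len : ℝ) * G (i + 1) s
              + ((∑ o : SameIdx s, G (i + 1) (s.negTwistAt o)) - ∑ o : InvIdx s, G (i + 1) (s.posTwistAt o))
              + ((∑ o : MergeIdx s, G i (s.negMergeAt o)) - ∑ o : MergeIdx s, G i (s.posMergeAt o))) →
        ∀ i, i ≤ k → ∀ s : LoopSeq d, IsLoopSeq s → G (i + 2) s = F (i + 2) β s) := by
  obtain ⟨β₀, hpos, hanti, C, L, F, hF0, hF1, H⟩ := oneOverN_expansion d hd
  have hnilS : IsLoopSeq ([] : LoopSeq d) := fun l hl => by simp at hl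
  -- (a) normalised constants
  have hC0 : ∀ k, 0 ≤ C k := by
    intro k
    obtain ⟨hnil, hb, -, -⟩ := H k 0 (by rw [abs_zero]; exact (hpos k).le)
    have h := hb [] hnilS
    rw [hnil, LoopSeq.len_nil, pow_zero, mul_one] at h
    split_ifs at h <;> linarith [abs_nonneg (1 : ℝ), abs_nonneg (0 : ℝ), h]
  set L' : ℕ → ℝ := fun k => max |L k| 1 with hL'
  have hL'1 : ∀ k, 1 ≤ L' k := fun k => le_max_right _ _
  have hbound : ∀ (k : ℕ) (β : ℝ), |β| ≤ β₀ k → ∀ s : LoopSeq d, IsLoopSeq s → |F (k + 2) β s| ≤ C k * L' k ^ s.len := by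
    intro k β hβ s hs
    refine ((H k β hβ).2.1 s hs).trans (mul_le_mul_of_nonneg_left ?_ (hC0 k))
    calc L k ^ s.len ≤ |L k ^ s.len| := le_abs_self _
      _ = |L k| ^ s.len := abs_pow _ _
      _ ≤ L' k ^ s.len := pow_le_pow_left₀ (abs_nonneg _) (le_max_left _ _) _
  -- the thresholds for (B)
  have hKd := one_le_bigK d
  have hβT : (0 : ℝ) < 1 / (2 * bigK d ^ 5) := by positivity
  obtain ⟨βz, hβz, Uz⟩ := symmetrized_unique (d := d) (M := max (C 0) 2) (L := max (L' 0) (4 * bigK d))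
    (le_max_of_le_right (by norm_num)) (le_max_of_le_left (hL'1 0))
  set β₀' : ℕ → ℝ := fun k => min (β₀ k) (min (1 / (2 * bigK d ^ 5)) βz) with hβ₀'
  have hβ₀'le : ∀ k, β₀' k ≤ β₀ k := fun k => min_le_left _ _
  refine ⟨β₀', fun k => lt_min (hpos k) (lt_min hβT hβz), fun k => min_le_min (hanti k) le_rfl, C, L', hC0, hL'1, F, hF0, hF1,
    fun k β hβ => ?_, ?_, ?_⟩
  · obtain ⟨h1, -, h3, h4⟩ := H k β (hβ.trans (hβ₀'le k))
    exact ⟨h1, hbound k β (hβ.trans (hβ₀'le k)), h3, h4⟩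
  · -- (B) `f_0 = T`
    intro β hβ s hs
    have hb0 : |β| ≤ β₀ 0 := hβ.trans (hβ₀'le 0)
    have hbT : |β| ≤ 1 / (2 * bigK d ^ 5) := hβ.trans ((min_le_right _ _).trans (min_le_left _ _))
    have hbz : |β| ≤ βz := hβ.trans ((min_le_right _ _).trans (min_le_right _ _))
    obtain ⟨hnil, -, heq, -⟩ := H 0 β hb0
    refine Uz β hbz (F 2 β) (fun t => ∑' X : Trajectory t, X.weight β) (by rw [hnil, if_pos rfl, trajectorySum_nil])
      (fun t ht => (hbound 0 β hb0 t ht).trans ?_) (fun t ht => (trajectorySum_summable_and_abs_le hbT ht).2.trans ?_)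
      (fun t ht hne => ?_) (fun t ht hne => trajectorySum_equation hbT ht hne) s hs
    · exact mul_le_mul (le_max_left _ _) (pow_le_pow_left₀ (by linarith [hL'1 0]) (le_max_left _ _) _)
        (pow_nonneg (by linarith [hL'1 0]) _) (le_max_of_le_right (by norm_num))
    · exact mul_le_mul (le_max_right _ _) (pow_le_pow_left₀ (by positivity) (le_max_right _ _) _)
        (pow_nonneg (by positivity) _) (le_max_of_le_right (by norm_num))
    · have h := heq t ht hne
      simp only [hF0, hF1, mul_zero, Finset.sum_const_zero, sub_self, add_zero] at h
      linarith
  · -- (C) uniqueness of the hierarchy, by induction on `k`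
    intro k
    induction k with
    | zero =>
      intro Mb Lb hMb hLb
      obtain ⟨βw, hβw, Uw⟩ := sourced_symmetrized_unique (d := d) (M := max Mb (C 0)) (L := max Lb (L' 0))
        (le_max_of_le_left hMb) (le_max_of_le_left hLb)
      refine ⟨min (β₀ 0) βw, lt_min (hpos 0) hβw, fun β hβ G hG0 hG1 hGnil hGb hGeq i hi s hs => ?_⟩
      obtain rfl : i = 0 := Nat.le_zero.mp hi
      have hb0 : |β| ≤ β₀ 0 := hβ.trans (min_le_left _ _)
      obtain ⟨hnil, -, heq, -⟩ := H 0 β hb0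
      refine Uw β (hβ.trans (min_le_right _ _)) (fun _ => 0) (G 2) (F 2 β)
        (by rw [hGnil 0 le_rfl, hnil]) (fun t ht => (hGb 0 le_rfl t ht).trans ?_)
        (fun t ht => (hbound 0 β hb0 t ht).trans ?_) (fun t ht hne => ?_) (fun t ht hne => ?_) s hs
      · exact mul_le_mul (le_max_left _ _) (pow_le_pow_left₀ (by linarith) (le_max_left _ _) _)
          (pow_nonneg (by linarith) _) (le_max_of_le_left hMb)
      · exact mul_le_mul (le_max_right _ _) (pow_le_pow_left₀ (by linarith [hL'1 0]) (le_max_right _ _) _)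
          (pow_nonneg (by linarith [hL'1 0]) _) (le_max_of_le_left hMb)
      · have h := hGeq 0 le_rfl t ht hne
        simp only [hG0, hG1, mul_zero, Finset.sum_const_zero, sub_self, add_zero] at h
        exact h
      · have h := heq t ht hne
        simp only [hF0, hF1, mul_zero, Finset.sum_const_zero, sub_self, add_zero] at h
        exact h
    | succ k ih =>
      intro Mb Lb hMb hLb
      obtain ⟨βk, hβk, Uk⟩ := ih Mb Lb hMb hLb
      obtain ⟨βw, hβw, Uw⟩ := sourced_symmetrized_unique (d := d) (M := max Mb (C (k + 1))) (L := max Lb (L' (k + 1)))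
        (le_max_of_le_left hMb) (le_max_of_le_left hLb)
      refine ⟨min βk (min (β₀ (k + 1)) βw), lt_min hβk (lt_min (hpos _) hβw),
        fun β hβ G hG0 hG1 hGnil hGb hGeq i hi s hs => ?_⟩
      have hbk : |β| ≤ βk := hβ.trans (min_le_left _ _)
      have hb1 : |β| ≤ β₀ (k + 1) := hβ.trans ((min_le_right _ _).trans (min_le_left _ _))
      have hbw : |β| ≤ βw := hβ.trans ((min_le_right _ _).trans (min_le_right _ _))
      -- the lower coefficients agree
      have hlow : ∀ i, i ≤ k → ∀ t : LoopSeq d, IsLoopSeq t → G (i + 2) t = F (i + 2) β t :=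
        Uk β hbk G hG0 hG1 (fun i hi => hGnil i (Nat.le_succ_of_le hi)) (fun i hi => hGb i (Nat.le_succ_of_le hi))
          (fun i hi => hGeq i (Nat.le_succ_of_le hi))
      rcases Nat.lt_or_ge i (k + 1) with hik | hik
      · exact hlow i (Nat.lt_succ_iff.mp hik) s hs
      obtain rfl : i = k + 1 := le_antisymm hi hik
      -- the top coefficient: same sourced equation
      obtain ⟨hnil, -, heq, -⟩ := H (k + 1) β hb1
      have hprev : ∀ t : LoopSeq d, IsLoopSeq t → G (k + 2) t = F (k + 2) β t := hlow k le_rfl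
      have hprev' : ∀ t : LoopSeq d, IsLoopSeq t → G (k + 1) t = F (k + 1) β t := by
        intro t ht
        rcases k with _ | k
        · rw [hG1, hF1]
        · exact hlow k (Nat.le_succ k) t ht
      refine Uw β hbw (fun t => (t.len : ℝ) * F (k + 2) β t
          + ((∑ o : SameIdx t, F (k + 2) β (t.negTwistAt o)) - ∑ o : InvIdx t, F (k + 2) β (t.posTwistAt o))
          + ((∑ o : MergeIdx t, F (k + 1) β (t.negMergeAt o)) - ∑ o : MergeIdx t, F (k + 1) β (t.posMergeAt o)))
        (G (k + 1 + 2)) (F (k + 1 + 2) β) (by rw [hGnil (k + 1) le_rfl, hnil])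
        (fun t ht => (hGb (k + 1) le_rfl t ht).trans ?_) (fun t ht => (hbound (k + 1) β hb1 t ht).trans ?_)
        (fun t ht hne => ?_) (fun t ht hne => heq t ht hne) s hs
      · exact mul_le_mul (le_max_left _ _) (pow_le_pow_left₀ (by linarith) (le_max_left _ _) _)
          (pow_nonneg (by linarith) _) (le_max_of_le_left hMb)
      · exact mul_le_mul (le_max_right _ _) (pow_le_pow_left₀ (by linarith [hL'1 (k + 1)]) (le_max_right _ _) _)
          (pow_nonneg (by linarith [hL'1 (k + 1)]) _) (le_max_of_le_left hMb)
      · rw [hGeq (k + 1) le_rfl t ht hne, hprev t ht]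
        simp only [hprev _ (ht.negTwistAt _), hprev _ (ht.posTwistAt _), hprev' _ (ht.negMergeAt _),
          hprev' _ (ht.posMergeAt _)]

end StringDuality

end Summit.QuantumFields.GaugeBoot

end
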